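import Mathlib.Geometry.Manifold.ContMDiffMFDeriv
import HarnessLib

/-!
# The time derivative of a smooth space-time function is smooth — any model, any time set
(topic `Geometry/Manifold`)

For a `C^∞` manifold `M` over an ARBITRARY model with corners `I` (boundary and corners allowed,
no `I.Boundaryless` / `BoundarylessManifold` hypothesis), a set of times `S ⊆ ℝ` with unique
derivatives, and a map `u : ℝ → M → F` into a real normed space with `(x, t) ↦ u t x` of class
`C^∞` on `M × S`, the time derivative `(x, t) ↦ ∂ₜu(t, x) = derivWithin (u · x) S t` is again
`C^∞` on `M × S` (`contMDiffOn_derivWithin_time`; whole time line: `contMDiff_deriv_time`,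
`contMDiff_deriv_time'` for the argument order `ℝ × M`).

This strictly generalises the tree's `contMDiffOn_derivWithin_time_of_uniqueDiffOn` /
`continuousOn_derivWithin_time` (`Geometry/Riemannian/TimeDerivativeContinuity.lean`, boundaryless
MODEL), `contMDiff_deriv_time` (`Geometry/Riemannian/LinearHeatWeakExistence.lean`, sources charted
on `ℝ^m`) and `continuous_deriv_time` (`Geometry/Riemannian/EnergyMinimisingMaps.lean`,
`BoundarylessManifold`), all proved by reading `u` in a chart of `M`, which needs an open chart
target. The present proof never charts `M`: the time derivative is the derivative of the
parametrised family `(x, t) ↦ (s ↦ u s x)` in the sense of Mathlib's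
`ContMDiffWithinAt.mfderivWithin` (the derivative of a `C^{n+1}` family with respect to the
inner variable is `C^n` in the parameter, read in tangent coordinates), and for the inner
manifold `ℝ` and the target `F` — both model vector spaces — the tangent coordinates are the
identity (`inTangentCoordinates_model_space`), so that the coordinate expression IS
`mfderivWithin = fderivWithin`, whose value at `1` is `derivWithin`.

Everything is proved; no definitions, no named facts. Standard calculus. [folklore]
-/

noncomputable section

open Set Function Filter
open scoped Manifold ContDiff Topology

namespace Literature.Geometry.Manifold

variable {E : Type*} [NormedAddCommGroup E] [NormedSpace ℝ E] {H : Type*} [TopologicalSpace H]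
  {I : ModelWithCorners ℝ E H} {M : Type*} [TopologicalSpace M] [ChartedSpace H M]
  {F : Type*} [NormedAddCommGroup F] [NormedSpace ℝ F]

/-- On the model line, `mfderivWithin` applied to `1` is `derivWithin` (at a point of unique
differentiability where the function is differentiable within the set). [folklore] -/
theorem mfderivWithin_apply_one_eq_derivWithin {φ : ℝ → F} {S : Set ℝ} {t : ℝ}
    (hφ : DifferentiableWithinAt ℝ φ S t) (hS : UniqueDiffWithinAt ℝ S t) :
    mfderivWithin 𝓘(ℝ, ℝ) 𝓘(ℝ, F) φ S t (1 : ℝ) = derivWithin φ S t := by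
  have hm : HasMFDerivWithinAt 𝓘(ℝ, ℝ) 𝓘(ℝ, F) φ S t
      (ContinuousLinearMap.smulRight (1 : ℝ →L[ℝ] ℝ) (derivWithin φ S t)) :=
    hφ.hasDerivWithinAt.hasFDerivWithinAt.hasMFDerivWithinAt
  rw [hm.mfderivWithin (uniqueMDiffWithinAt_iff_uniqueDiffWithinAt.2 hS)]
  change ((1 : ℝ →L[ℝ] ℝ) (1 : ℝ)) • derivWithin φ S t = derivWithin φ S t
  rw [one_apply_eq_self]
  exact one_smul _ _

/-- On the model line, `mfderiv` applied to `1` is `deriv`. [folklore] -/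
theorem mfderiv_apply_one_eq_deriv {φ : ℝ → F} {t : ℝ} (hφ : DifferentiableAt ℝ φ t) :
    mfderiv 𝓘(ℝ, ℝ) 𝓘(ℝ, F) φ t (1 : ℝ) = deriv φ t := by
  rw [← mfderivWithin_univ, ← derivWithin_univ]
  exact mfderivWithin_apply_one_eq_derivWithin hφ.differentiableWithinAt uniqueDiffWithinAt_univ

variable [IsManifold I ∞ M]

/-- **The time derivative of a `C^∞` space-time function is `C^∞` — within a time set, any
model.** Let `S ⊆ ℝ` have unique derivatives (`UniqueDiffOn`, e.g. any interval with more than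
one point) and let `u : ℝ → M → F` be such that `(x, t) ↦ u t x` is `C^∞` on `M × S`. Then
`(x, t) ↦ derivWithin (u · x) S t` is `C^∞` on `M × S`. No hypothesis on the boundary of `M` or of
its model. [folklore] -/
theorem contMDiffOn_derivWithin_time {u : ℝ → M → F} {S : Set ℝ} (hS : UniqueDiffOn ℝ S)
    (hu : ContMDiffOn (I.prod 𝓘(ℝ, ℝ)) 𝓘(ℝ, F) ∞ (fun p : M × ℝ ↦ u p.2 p.1) (univ ×ˢ S)) :
    ContMDiffOn (I.prod 𝓘(ℝ, ℝ)) 𝓘(ℝ, F) ∞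
      (fun p : M × ℝ ↦ derivWithin (fun s ↦ u s p.1) S p.2) (univ ×ˢ S) := by
  rintro ⟨x₀, t₀⟩ hp₀
  have ht₀ : t₀ ∈ S := hp₀.2
  -- the family `(x, t) ↦ (s ↦ u s x)`, jointly `C^∞` on `(M × S) × S`
  have hf : ContMDiffWithinAt ((I.prod 𝓘(ℝ, ℝ)).prod 𝓘(ℝ, ℝ)) 𝓘(ℝ, F) ∞
      (Function.uncurry fun (p : M × ℝ) (s : ℝ) ↦ u s p.1) ((univ ×ˢ S) ×ˢ S)
      ((x₀, t₀), t₀) := by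
    have h1 : ContMDiffWithinAt (I.prod 𝓘(ℝ, ℝ)) 𝓘(ℝ, F) ∞ (fun p : M × ℝ ↦ u p.2 p.1)
        (univ ×ˢ S) (x₀, t₀) := hu _ hp₀
    have h2 : ContMDiffWithinAt ((I.prod 𝓘(ℝ, ℝ)).prod 𝓘(ℝ, ℝ)) (I.prod 𝓘(ℝ, ℝ)) ∞
        (fun q : (M × ℝ) × ℝ ↦ ((q.1.1, q.2) : M × ℝ)) ((univ ×ˢ S) ×ˢ S) ((x₀, t₀), t₀) :=
      (contMDiffWithinAt_fst.comp _ contMDiffWithinAt_fst (mapsTo_image _ _)).prodMk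
        contMDiffWithinAt_snd
    exact h1.comp_of_eq h2 (fun q hq ↦ mk_mem_prod (mem_univ _) hq.2) rfl
  have h := ContMDiffWithinAt.mfderivWithin (I := 𝓘(ℝ, ℝ)) (I' := 𝓘(ℝ, F)) (m := ∞) hf
    contMDiffWithinAt_snd hp₀ (fun p hp ↦ hp.2) (by exact_mod_cast le_top)
    (uniqueMDiffOn_iff_uniqueDiffOn.2 hS)
  rw [inTangentCoordinates_model_space] at h
  have h1 : ContMDiffWithinAt (I.prod 𝓘(ℝ, ℝ)) 𝓘(ℝ, F) ∞
      (fun p : M × ℝ ↦ mfderivWithin 𝓘(ℝ, ℝ) 𝓘(ℝ, F) (fun s ↦ u s p.1) S p.2 (1 : ℝ))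
      (univ ×ˢ S) (x₀, t₀) :=
    h.clm_apply contMDiffWithinAt_const
  refine h1.congr_of_eventuallyEq_of_mem ?_ hp₀
  filter_upwards [self_mem_nhdsWithin] with p hp
  -- the time slice through `p` is `C^∞` on `S`, hence differentiable within `S` at `p.2`
  have hsl : ContMDiffOn 𝓘(ℝ, ℝ) 𝓘(ℝ, F) ∞ (fun s ↦ u s p.1) S := by
    have hι : ContMDiff 𝓘(ℝ, ℝ) (I.prod 𝓘(ℝ, ℝ)) ∞ (fun s : ℝ ↦ ((p.1, s) : M × ℝ)) :=
      contMDiff_const.prodMk contMDiff_id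
    exact hu.comp hι.contMDiffOn fun s hs ↦ mk_mem_prod (mem_univ _) hs
  have hd : DifferentiableWithinAt ℝ (fun s ↦ u s p.1) S p.2 :=
    (contMDiffOn_iff_contDiffOn.1 hsl).differentiableOn (by simp) p.2 hp.2
  exact (mfderivWithin_apply_one_eq_derivWithin hd (hS p.2 hp.2)).symm

/-- **The time derivative of a `C^∞` function on `M × ℝ` is `C^∞` on `M × ℝ`** (argument order
`M × ℝ`; any model with corners for `M`). [folklore] -/
theorem contMDiff_deriv_time {u : ℝ → M → F}
    (hu : ContMDiff (I.prod 𝓘(ℝ, ℝ)) 𝓘(ℝ, F) ∞ (fun p : M × ℝ ↦ u p.2 p.1)) :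
    ContMDiff (I.prod 𝓘(ℝ, ℝ)) 𝓘(ℝ, F) ∞ (fun p : M × ℝ ↦ deriv (fun s ↦ u s p.1) p.2) := by
  have h := contMDiffOn_derivWithin_time (I := I) uniqueDiffOn_univ
    (by rw [univ_prod_univ]; exact hu.contMDiffOn)
  rw [univ_prod_univ] at h
  simpa only [derivWithin_univ] using contMDiffOn_univ.1 h

/-- **The time derivative of a `C^∞` function on `ℝ × M` is `C^∞` on `ℝ × M`** (argument order
`ℝ × M`, as in deformations `F : ℝ → M → N` of maps; any model with corners for `M`). [folklore] -/
theorem contMDiff_deriv_time' {u : ℝ → M → F}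
    (hu : ContMDiff (𝓘(ℝ, ℝ).prod I) 𝓘(ℝ, F) ∞ (fun p : ℝ × M ↦ u p.1 p.2)) :
    ContMDiff (𝓘(ℝ, ℝ).prod I) 𝓘(ℝ, F) ∞ (fun p : ℝ × M ↦ deriv (fun s ↦ u s p.2) p.1) := by
  have hu' : ContMDiff (I.prod 𝓘(ℝ, ℝ)) 𝓘(ℝ, F) ∞ (fun p : M × ℝ ↦ u p.2 p.1) :=
    hu.comp (contMDiff_snd.prodMk contMDiff_fst)
  exact (contMDiff_deriv_time hu').comp (contMDiff_snd.prodMk contMDiff_fst)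

/-- The time derivative of a `C^∞` function on `M × S` is jointly continuous on `M × S` (any
model with corners; compare `continuousOn_derivWithin_time`, which needs a boundaryless model).
[folklore] -/
theorem continuousOn_derivWithin_time' {u : ℝ → M → F} {S : Set ℝ} (hS : UniqueDiffOn ℝ S)
    (hu : ContMDiffOn (I.prod 𝓘(ℝ, ℝ)) 𝓘(ℝ, F) ∞ (fun p : M × ℝ ↦ u p.2 p.1) (univ ×ˢ S)) :
    ContinuousOn (fun p : M × ℝ ↦ derivWithin (fun s ↦ u s p.1) S p.2) (univ ×ˢ S) :=
  (contMDiffOn_derivWithin_time hS hu).continuousOn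

omit [IsManifold I ∞ M] in
/-- Each time slice `s ↦ u s x` of a `C^∞` function on `M × S` has the derivative
`derivWithin (u · x) S t` within `S` at every `t ∈ S`. [folklore] -/
theorem hasDerivWithinAt_time_slice {u : ℝ → M → F} {S : Set ℝ}
    (hu : ContMDiffOn (I.prod 𝓘(ℝ, ℝ)) 𝓘(ℝ, F) ∞ (fun p : M × ℝ ↦ u p.2 p.1) (univ ×ˢ S))
    (x : M) {t : ℝ} (ht : t ∈ S) :
    HasDerivWithinAt (fun s ↦ u s x) (derivWithin (fun s ↦ u s x) S t) S t := by
  have hsl : ContMDiffOn 𝓘(ℝ, ℝ) 𝓘(ℝ, F) ∞ (fun s ↦ u s x) S := by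
    have hι : ContMDiff 𝓘(ℝ, ℝ) (I.prod 𝓘(ℝ, ℝ)) ∞ (fun s : ℝ ↦ ((x, s) : M × ℝ)) :=
      contMDiff_const.prodMk contMDiff_id
    exact hu.comp hι.contMDiffOn fun s hs ↦ mk_mem_prod (mem_univ _) hs
  exact ((contMDiffOn_iff_contDiffOn.1 hsl).differentiableOn (by simp) t ht).hasDerivWithinAt

end Literature.Geometry.Manifold

end
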